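import Literature.Barriers.CriticalPhenomena.WeaklySAWFlowTheorem
import Literature.Barriers.CriticalPhenomena.WeaklySAWQuadraticFlowContinuity
import HarnessLib

/-!
# [BBS-rg-flow, Corollary 1.8]: continuity of the critical flow in an external parameter and in the
# initial condition

Fifteenth file of the series formalising [BBS-rg-flow] (Bauerschmidt–Brydges–Slade, AHP 16 (2015),
arXiv:1211.2477), the abstract dynamical-system input of BBS 2015, Theorem 4.1 (via its Theorem 7.2.1),
towards `Literature.Barriers.CriticalPhenomena.WeaklySAWFourDimLogCorrections`; continuation of
`WeaklySAWFlowTheorem.lean` (Theorem 1.4(i): existence, bounds, uniqueness of the flow at an admissible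
initial condition) and `WeaklySAWQuadraticFlowContinuity.lean` (continuity of `V̄_j` in `(m, g₀)`).

BBS 2015, §8 constructs the critical point from the initial values `(z₀, μ₀)` of the flow of Theorem
7.2.1 and needs their CONTINUITY in the external parameter (the mass `m²`) and in `g₀`; in [BBS-rg-flow]
this is Corollary 1.8, proved there — and here — from the UNIQUENESS clause of Theorem 1.4 alone:
* `ConstHyp` (the standing constants and `𝗁 ≥ 𝗁_*`), `Adm` (the admissible `(m, K₀, g₀)`: `0 < g₀ ≤ g_*`,
  `‖K₀‖ ≤ a_*g₀³`, (A3) at `(m, g₀)`), `critFlow` (the unique flow of `BBS_thm14_exists_flow`, chosen by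
  `Classical.choose`; `critFlow_spec`);
* `continuous_map_param` (`φ̄_j(m)` jointly continuous), `norm_Kb_le` (Lemma 1.3 at admissible points),
  `mem_flowDomain_of_boundAt`, the uniform bound `‖V₀‖ ≤ R_V` (`norm_critFlow_zero_le`, for compactness
  in `ℝ³`), `boundAt_of_tendsto` (passing to the limit in (1.11)–(1.14));
* the orbit argument `critFlow_tendsto_of_tendsto_zero`: along any non-trivial filter of admissible points
  converging to `q₀ = (m, u₀)` along which `V₀ → V₀^*`, the `Φ(m)`-orbit `x^*` of `(K₀, V₀^*)` is the
  limit of the flows, is a flow with the boundary conditions and the bounds at `q₀`, hence equals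
  `x(m, u₀)` by uniqueness — so the flows converge to `x(m, u₀)` scale by scale;
* **Corollary 1.8** (`critFlow_continuousWithinAt`): for `Φ_j` continuous in `(m, x)` at the points of the
  domains `D_j`, coefficients of `φ̄(m)` continuous in `m`, (A1)–(A3) for every `m` with `m`-independent
  parameters, and `χ_j(m') → χ_j(m)` (used implicitly in the printed proof, "Since `χ_j(m') → χ_j(m)`";
  made an explicit hypothesis here), each `x_j` is continuous in `(m, K₀, g₀)` at every admissible point
  within the admissible set (`IsCompact.tendsto_nhds_of_unique_mapClusterPt` for `V₀`, then the orbit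
  argument).

## References
* R. Bauerschmidt, D. C. Brydges, G. Slade, *Structural stability of a dynamical system near a
  non-hyperbolic fixed point*, Ann. Henri Poincaré 16 (2015), arXiv:1211.2477: Corollary 1.8 and its
  proof, Theorem 1.4(i), Proposition 1.2, Lemma 1.3. [BauerschmidtBrydgesSlade2015Flow]
* R. Bauerschmidt, D. C. Brydges, G. Slade, CMP 338 (2015), Theorem 7.2.1 and §8. [BauerschmidtBrydgesSlade2015LogCorr]
-/

noncomputable section

open Filter Topology Set
open scoped BigOperators

namespace Literature.Barriers.CriticalPhenomena

namespace CTWSAW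

/-! ## [BBS-rg-flow, Corollary 1.8]: continuity of the critical flow in an external parameter and in
the initial condition — set-up -/

section Corollary18

variable {Mext : Type*}
variable {W : ℕ → Type*} [∀ j, NormedAddCommGroup (W j)] [∀ j, NormedSpace ℝ (W j)] [∀ j, CompleteSpace (W j)]

/-- The constants of Theorem 1.4 and their standing inequalities (`1 < Ω`, `0 < κ`, `κΩ < 1`, `0 < R`,
`0 < M`, `R/(1-κΩ) < a_* < a`, `0 < b < 1`, `𝗁 ≥ 𝗁_*`). [cite: BauerschmidtBrydgesSlade2015Flow, Theorem 1.4 (hypotheses)] -/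
structure ConstHyp (Ω c lam C a κ R M aStar b hh : ℝ) : Prop where
  /-- `Ω > 1`. -/
  one_lt_Ω : 1 < Ω
  /-- `κ > 0`. -/
  κ_pos : 0 < κ
  /-- `κΩ < 1`. -/
  κΩ_lt : κ * Ω < 1
  /-- `R > 0`. -/
  R_pos : 0 < R
  /-- `M > 0`. -/
  M_pos : 0 < M
  /-- `a_* > R/(1-κΩ)`. -/
  aStar_gt : R / (1 - κ * Ω) < aStar
  /-- `a_* < a`. -/
  aStar_lt : aStar < a
  /-- `b > 0`. -/
  b_pos : 0 < b
  /-- `b < 1`. -/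
  b_lt : b < 1
  /-- `𝗁 ≥ 𝗁_*`. -/
  hh_ge : hThreshold Ω c C lam M a aStar κ b ≤ hh

variable (Pf : Mext → QuadFlowParams) (ψf : ∀ m : Mext, ∀ j, W j × V3 → W (j + 1)) (ρf : ∀ m : Mext, ∀ j, W j × V3 → V3)
  (Ω B c lam C a κ R M aStar b hh : ℝ)

/-- The admissible parameter points `q = (m, K₀, g₀)`: `0 < g₀ ≤ g_*`, `‖K₀‖ ≤ a_*g₀³` and (A3) at
`(m, g₀)` (the set `𝓘` of Theorem 1.4 over all `m`). [cite: BauerschmidtBrydgesSlade2015Flow, Theorem 1.4 and Corollary 1.8] -/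
def Adm (q : Mext × (W 0 × ℝ)) : Prop :=
  0 < q.2.2 ∧ q.2.2 ≤ gThreshold Ω B c C lam M a aStar κ R b hh ∧ ‖q.2.1‖ ≤ aStar * q.2.2 ^ 3 ∧
    HypA3 (chi (Pf q.1).β Ω) (ψf q.1) (ρf q.1) ((Pf q.1).flow q.2.2) a hh κ Ω R M

variable {Pf Ω B c lam C a κ R M aStar b hh}

open Classical in
/-- **The critical flow** `x(m, u₀) = (K_j, V_j)_j(m, K₀, g₀)`: the unique global flow of
`Φ(m) = (ψ(m), φ̄(m) + ρ(m))` with `K₀`, `g₀` prescribed, `(z_∞, μ_∞) = (0,0)` and the bounds (1.11)–(1.14)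
given by Theorem 1.4(i) (`BBS_thm14_exists_flow`) at admissible `q`; `0` elsewhere.
[cite: BauerschmidtBrydgesSlade2015Flow, Corollary 1.8 ("the global flow … guaranteed by Theorem 1.4")] -/
def critFlow (hc : ConstHyp Ω c lam C a κ R M aStar b hh)
    (hA : ∀ m, HypA1 (Pf m).β Ω B c ∧ HypA2 (Pf m) Ω lam c C) (q : Mext × (W 0 × ℝ)) : ∀ j, W j × V3 :=
  if hq : Adm Pf ψf ρf Ω B c lam C a κ R M aStar b hh q then
    Classical.choose (BBS_thm14_exists_flow hc.one_lt_Ω hc.κ_pos hc.κΩ_lt hc.R_pos hc.M_pos hc.aStar_gt hc.aStar_lt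
      hc.b_pos hc.b_lt hh hc.hh_ge (Pf q.1) (ψf q.1) (ρf q.1) (hA q.1).1 (hA q.1).2 hq.1 hq.2.1 hq.2.2.2 hq.2.2.1)
  else fun _ => 0

/-- The defining properties of the critical flow at an admissible point: it lies in `∏D_j`, is a flow of
`Φ(m)`, has `K₀`, `g₀` prescribed, `(z_j, μ_j) → 0`, obeys (1.11)–(1.14), and is unique with these properties.
[cite: BauerschmidtBrydgesSlade2015Flow, Theorem 1.4(i)] -/
theorem critFlow_spec (hc : ConstHyp Ω c lam C a κ R M aStar b hh)
    (hA : ∀ m, HypA1 (Pf m).β Ω B c ∧ HypA2 (Pf m) Ω lam c C) {q : Mext × (W 0 × ℝ)}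
    (hq : Adm Pf ψf ρf Ω B c lam C a κ R M aStar b hh q) :
    (∀ j, critFlow ψf ρf hc hA q j ∈ flowDomain (chi (Pf q.1).β Ω) ((Pf q.1).flow q.2.2) a hh j) ∧
    IsPerturbedFlow (Pf q.1) (ψf q.1) (ρf q.1) (critFlow ψf ρf hc hA q) ∧
    (critFlow ψf ρf hc hA q 0).1 = q.2.1 ∧ (critFlow ψf ρf hc hA q 0).2 0 = q.2.2 ∧
    Tendsto (fun j => (critFlow ψf ρf hc hA q j).2 1) atTop (𝓝 0) ∧ Tendsto (fun j => (critFlow ψf ρf hc hA q j).2 2) atTop (𝓝 0) ∧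
    FlowBounds (chi (Pf q.1).β Ω) (ψf q.1) ((Pf q.1).flow q.2.2) q.2.1 a aStar hh b (critFlow ψf ρf hc hA q) ∧
    ∀ x' : ∀ j, W j × V3, IsPerturbedFlow (Pf q.1) (ψf q.1) (ρf q.1) x' → (x' 0).1 = q.2.1 → (x' 0).2 0 = q.2.2 →
      Tendsto (fun j => (x' j).2 1) atTop (𝓝 0) → Tendsto (fun j => (x' j).2 2) atTop (𝓝 0) →
      FlowBounds (chi (Pf q.1).β Ω) (ψf q.1) ((Pf q.1).flow q.2.2) q.2.1 a aStar hh b x' → x' = critFlow ψf ρf hc hA q := by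
  have hdef : critFlow ψf ρf hc hA q = Classical.choose (BBS_thm14_exists_flow hc.one_lt_Ω hc.κ_pos hc.κΩ_lt hc.R_pos hc.M_pos
      hc.aStar_gt hc.aStar_lt hc.b_pos hc.b_lt hh hc.hh_ge (Pf q.1) (ψf q.1) (ρf q.1) (hA q.1).1 (hA q.1).2
      hq.1 hq.2.1 hq.2.2.2 hq.2.2.1) := by
    simp only [critFlow, dif_pos hq]
  rw [hdef]
  exact Classical.choose_spec (BBS_thm14_exists_flow hc.one_lt_Ω hc.κ_pos hc.κΩ_lt hc.R_pos hc.M_pos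
      hc.aStar_gt hc.aStar_lt hc.b_pos hc.b_lt hh hc.hh_ge (Pf q.1) (ψf q.1) (ρf q.1) (hA q.1).1 (hA q.1).2
      hq.1 hq.2.1 hq.2.2.2 hq.2.2.1)

variable [TopologicalSpace Mext]

omit [∀ j, CompleteSpace (W j)] in
/-- `φ̄_j(m)(V)` is jointly continuous in `(m, V)` (a polynomial with continuous coefficients).
[cite: BauerschmidtBrydgesSlade2015Flow, (1.1)–(1.3) and Corollary 1.8 ("Φ_j continuous")] -/
theorem continuous_map_param {Pf : Mext → QuadFlowParams} (hP : CoeffContinuous Pf) (j : ℕ) :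
    Continuous fun q : Mext × V3 => (Pf q.1).map j q.2 := by
  have hc : ∀ i : Fin 3, Continuous fun q : Mext × V3 => q.2 i := fun i =>
    (continuous_apply i).comp continuous_snd
  have h0 := hc 0; have h1 := hc 1; have h2 := hc 2
  refine continuous_pi fun i => ?_
  fin_cases i
  · simp only [Fin.zero_eta, Fin.isValue, QuadFlowParams.map_apply_zero]
    exact h0.sub (((hP.β j).comp continuous_fst).mul (h0.pow 2))
  · simp only [Fin.mk_one, Fin.isValue, QuadFlowParams.map_apply_one]
    exact h1.sub ((((hP.θ j).comp continuous_fst).mul (h0.pow 2)).add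
      ((((hP.ζ j).comp continuous_fst).mul h0).mul h1))
  · simp only [Fin.reduceFinMk, Fin.isValue, QuadFlowParams.map_apply_two]
    exact (((((hP.η j).comp continuous_fst).mul h0).add (((hP.γ j).comp continuous_fst).mul h1)).add
      (((hP.lam j).comp continuous_fst).mul h2)).sub
      ((((((((hP.υgg j).comp continuous_fst).mul (h0.pow 2)).add ((((hP.υgz j).comp continuous_fst).mul h0).mul h1)).add
        ((((hP.υgμ j).comp continuous_fst).mul h0).mul h2)).add (((hP.υzz j).comp continuous_fst).mul (h1.pow 2))).add
        ((((hP.υzμ j).comp continuous_fst).mul h1).mul h2)))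

omit [∀ j, NormedSpace ℝ (W j)] [∀ j, CompleteSpace (W j)] [TopologicalSpace Mext] in
/-- A point obeying the `j`-th bounds (1.11)–(1.14) relative to `x̄_j = (K̄_j, V̄_j)` with `‖K̄_j‖ ≤ a_*χ_jḡ_j³`
lies in `D_j(g₀, a, h)` (`b ≤ 1`, `a_* + b(a - a_*) ≤ a`). [cite: BauerschmidtBrydgesSlade2015Flow, §3.2 ("the projection of x̄ + 𝔹 is contained in D_j")] -/
theorem mem_flowDomain_of_bounds {χ : ℕ → ℝ} {Vb : ℕ → V3} {a aStar hh b : ℝ} {j : ℕ} {Kb : W j} {x : W j × V3}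
    (hχ : 0 ≤ χ j) (hg : 0 ≤ Vb j 0) (hh0 : 0 ≤ hh) (hb1 : b ≤ 1) (haS : 0 ≤ a - aStar)
    (hKb : ‖Kb‖ ≤ aStar * χ j * Vb j 0 ^ 3)
    (h1 : ‖x.1 - Kb‖ ≤ b * (a - aStar) * χ j * Vb j 0 ^ 3)
    (h2 : |x.2 0 - Vb j 0| ≤ b * hh * Vb j 0 ^ 2 * |Real.log (Vb j 0)|)
    (h3 : |x.2 1 - Vb j 1| ≤ b * hh * χ j * Vb j 0 ^ 2 * |Real.log (Vb j 0)|)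
    (h4 : |x.2 2 - Vb j 2| ≤ b * hh * χ j * Vb j 0 ^ 2 * |Real.log (Vb j 0)|) :
    x ∈ flowDomain χ Vb a hh j := by
  have hL : 0 ≤ |Real.log (Vb j 0)| := abs_nonneg _
  have hw : 0 ≤ χ j * Vb j 0 ^ 3 := by positivity
  refine ⟨?_, ?_, ?_, ?_⟩
  · calc ‖x.1‖ = ‖Kb + (x.1 - Kb)‖ := by rw [add_sub_cancel]
      _ ≤ ‖Kb‖ + ‖x.1 - Kb‖ := norm_add_le _ _
      _ ≤ aStar * χ j * Vb j 0 ^ 3 + b * (a - aStar) * χ j * Vb j 0 ^ 3 := add_le_add hKb h1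
      _ = (aStar + b * (a - aStar)) * (χ j * Vb j 0 ^ 3) := by ring
      _ ≤ (aStar + 1 * (a - aStar)) * (χ j * Vb j 0 ^ 3) := by gcongr
      _ = a * χ j * Vb j 0 ^ 3 := by ring
  · calc |x.2 0 - Vb j 0| ≤ b * hh * Vb j 0 ^ 2 * |Real.log (Vb j 0)| := h2
      _ = b * (hh * Vb j 0 ^ 2 * |Real.log (Vb j 0)|) := by ring
      _ ≤ 1 * (hh * Vb j 0 ^ 2 * |Real.log (Vb j 0)|) := by gcongr
      _ = _ := one_mul _
  · calc |x.2 1 - Vb j 1| ≤ b * hh * χ j * Vb j 0 ^ 2 * |Real.log (Vb j 0)| := h3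
      _ = b * (hh * χ j * Vb j 0 ^ 2 * |Real.log (Vb j 0)|) := by ring
      _ ≤ 1 * (hh * χ j * Vb j 0 ^ 2 * |Real.log (Vb j 0)|) := by gcongr
      _ = _ := one_mul _
  · calc |x.2 2 - Vb j 2| ≤ b * hh * χ j * Vb j 0 ^ 2 * |Real.log (Vb j 0)| := h4
      _ = b * (hh * χ j * Vb j 0 ^ 2 * |Real.log (Vb j 0)|) := by ring
      _ ≤ 1 * (hh * χ j * Vb j 0 ^ 2 * |Real.log (Vb j 0)|) := by gcongr
      _ = _ := one_mul _

/-- From a map cluster point one extracts a finer non-trivial filter along which the map converges.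
[folklore] -/
theorem exists_le_tendsto_of_mapClusterPt {ι Y : Type*} [TopologicalSpace Y] {y : Y} {l : Filter ι} {f : ι → Y}
    (hy : MapClusterPt y l f) : ∃ F : Filter ι, F.NeBot ∧ F ≤ l ∧ Tendsto f F (𝓝 y) := by
  refine ⟨l ⊓ Filter.comap f (𝓝 y), ?_, inf_le_left, ?_⟩
  · have h1 : (Filter.map f (l ⊓ Filter.comap f (𝓝 y))).NeBot := by
      rw [Filter.push_pull]
      have : ClusterPt y (Filter.map f l) := hy
      rw [ClusterPt] at this
      rwa [inf_comm]
    exact Filter.NeBot.of_map h1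
  · rw [Tendsto, Filter.push_pull]
    exact inf_le_right

end Corollary18


/-! ### [BBS-rg-flow, Corollary 1.8]: the argument -/

section Corollary18b

variable {Mext : Type*}
variable {W : ℕ → Type*} [∀ j, NormedAddCommGroup (W j)] [∀ j, NormedSpace ℝ (W j)] [∀ j, CompleteSpace (W j)]
variable {Pf : Mext → QuadFlowParams} (ψf : ∀ m : Mext, ∀ j, W j × V3 → W (j + 1)) (ρf : ∀ m : Mext, ∀ j, W j × V3 → V3)
  {Ω B c lam C a κ R M aStar b hh : ℝ}

/-- `K̄_j(m, K₀, g₀)`. [cite: BauerschmidtBrydgesSlade2015Flow, §3.1, (3.3)] -/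
def Kb (Pf : Mext → QuadFlowParams) (q : Mext × (W 0 × ℝ)) (j : ℕ) : W j :=
  Kbar (ψf q.1) ((Pf q.1).flow q.2.2) q.2.1 j

/-- The `j`-th clause of the bounds (1.11)–(1.14) at the parameter point `q`. [cite: BauerschmidtBrydgesSlade2015Flow, Theorem 1.4, (1.11)–(1.14)] -/
def BoundAt (Pf : Mext → QuadFlowParams) (Ω a aStar hh b : ℝ) (q : Mext × (W 0 × ℝ)) (j : ℕ) (xj : W j × V3) : Prop :=
  ‖xj.1 - Kb ψf Pf q j‖ ≤ b * (a - aStar) * chi (Pf q.1).β Ω j * (Pf q.1).flow q.2.2 j 0 ^ 3 ∧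
    |xj.2 0 - (Pf q.1).flow q.2.2 j 0| ≤ b * hh * (Pf q.1).flow q.2.2 j 0 ^ 2 * |Real.log ((Pf q.1).flow q.2.2 j 0)| ∧
    |xj.2 1 - (Pf q.1).flow q.2.2 j 1| ≤ b * hh * chi (Pf q.1).β Ω j * (Pf q.1).flow q.2.2 j 0 ^ 2 * |Real.log ((Pf q.1).flow q.2.2 j 0)| ∧
    |xj.2 2 - (Pf q.1).flow q.2.2 j 2| ≤ b * hh * chi (Pf q.1).β Ω j * (Pf q.1).flow q.2.2 j 0 ^ 2 * |Real.log ((Pf q.1).flow q.2.2 j 0)|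

omit [∀ j, NormedSpace ℝ (W j)] [∀ j, CompleteSpace (W j)] in
/-- The bounds (1.11)–(1.14) clause by clause. [cite: BauerschmidtBrydgesSlade2015Flow, Theorem 1.4] -/
theorem flowBounds_iff_boundAt (q : Mext × (W 0 × ℝ)) (x : ∀ j, W j × V3) :
    FlowBounds (chi (Pf q.1).β Ω) (ψf q.1) ((Pf q.1).flow q.2.2) q.2.1 a aStar hh b x ↔
      ∀ j, BoundAt ψf Pf Ω a aStar hh b q j (x j) := Iff.rfl

omit [∀ j, CompleteSpace (W j)] in
/-- **Lemma 1.3 at an admissible point**: `‖K̄_j‖ ≤ a_*χ_jḡ_j³` (the threshold `g_*` was chosen so that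
`R + κa_*ϑ ≤ a_*`). [cite: BauerschmidtBrydgesSlade2015Flow, Lemma 1.3] -/
theorem norm_Kb_le (hc : ConstHyp Ω c lam C a κ R M aStar b hh)
    (hA : ∀ m, HypA1 (Pf m).β Ω B c ∧ HypA2 (Pf m) Ω lam c C) {q : Mext × (W 0 × ℝ)}
    (hq : Adm Pf ψf ρf Ω B c lam C a κ R M aStar b hh q) (j : ℕ) :
    ‖Kb ψf Pf q j‖ ≤ aStar * chi (Pf q.1).β Ω j * (Pf q.1).flow q.2.2 j 0 ^ 3 := by
  obtain ⟨hg₀, hgs, hK₀, hA3⟩ := hq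
  have hΩ := hc.one_lt_Ω; have hκ := hc.κ_pos; have hκΩ := hc.κΩ_lt; have hR := hc.R_pos
  have haStar := hc.aStar_gt
  have hΩ0 : 0 < Ω := by linarith
  have h1κ : 0 < 1 - κ * Ω := by linarith
  have ha0 : 0 < aStar := lt_trans (div_pos hR h1κ) haStar
  have hB : 0 ≤ B := (hA q.1).1.B_nonneg
  have hgq : q.2.2 ≤ quadThreshold Ω B c C lam :=
    hgs.trans ((min_le_left _ _).trans ((min_le_left _ _).trans (min_le_left _ _)))
  have hgr : q.2.2 ≤ (1 - (ratioMargin Ω κ R aStar)⁻¹) / (6 * B + 1) := hgs.trans ((min_le_left _ _).trans (min_le_right _ _))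
  obtain ⟨h, -, -⟩ := cutoffQuadHyp_of_hypA hΩ (hA q.1).1 (hA q.1).2 hg₀ hgq
  have hq1 : 1 < ratioMargin Ω κ R aStar := one_lt_ratioMargin hΩ0 hκ hκΩ hR haStar
  have hcube : ((1 - 2 * B * q.2.2)⁻¹) ^ 3 ≤ ratioMargin Ω κ R aStar := by
    refine inv_cube_le_of_small hB hg₀.le hq1.le ?_
    have h6 : 0 < 6 * B + 1 := by positivity
    have h7 := (le_div_iff₀ h6).1 hgr
    have e : q.2.2 * (6 * B + 1) = 6 * B * q.2.2 + q.2.2 := by ring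
    linarith [hg₀.le]
  have hϑ : stepRatio Ω B q.2.2 ≤ Ω * ratioMargin Ω κ R aStar := mul_le_mul_of_nonneg_left hcube hΩ0.le
  have hqR : ratioMargin Ω κ R aStar ≤ (aStar - R) / (κ * aStar * Ω) := (min_le_left _ _).trans (min_le_right _ _)
  have hϑR : R + κ * aStar * stepRatio Ω B q.2.2 ≤ aStar := by
    have hpos : 0 < κ * aStar * Ω := by positivity
    have h1 : ratioMargin Ω κ R aStar * (κ * aStar * Ω) ≤ aStar - R := (le_div_iff₀ hpos).1 hqR
    have h2 : κ * aStar * stepRatio Ω B q.2.2 ≤ κ * aStar * (Ω * ratioMargin Ω κ R aStar) :=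
      mul_le_mul_of_nonneg_left hϑ (by positivity)
    have h3 : κ * aStar * (Ω * ratioMargin Ω κ R aStar) = ratioMargin Ω κ R aStar * (κ * aStar * Ω) := by ring
    linarith
  have hχ : ∀ j, 0 ≤ cutoffWeight Ω (jOmega (Pf q.1).β Ω) j := fun j => (h.weight_pos j).le
  have hgb : ∀ j, 0 ≤ (Pf q.1).flow q.2.2 j 0 := fun j => by rw [QuadFlowParams.flow_apply_zero]; exact (h.gbar_pos j).le
  have hh0 : 0 ≤ hh := le_trans zero_le_one ((one_le_hThreshold Ω c C lam M a aStar κ b).trans hc.hh_ge)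
  have hratio : ∀ j, cutoffWeight Ω (jOmega (Pf q.1).β Ω) j * (Pf q.1).flow q.2.2 j 0 ^ 3 ≤
      stepRatio Ω B q.2.2 * (cutoffWeight Ω (jOmega (Pf q.1).β Ω) (j + 1) * (Pf q.1).flow q.2.2 (j + 1) 0 ^ 3) := fun j => by
    simpa [QuadFlowParams.flow_apply_zero, stepRatio] using h.toCutoffGbarHyp.weight_cube_le_mul_succ j
  have hK₀' : ‖q.2.1‖ ≤ aStar * cutoffWeight Ω (jOmega (Pf q.1).β Ω) 0 * (Pf q.1).flow q.2.2 0 0 ^ 3 := by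
    rw [cutoffWeight_eq_one_of_le (by simp), QuadFlowParams.flow_apply_zero, gbar_zero]; simpa using hK₀
  have hA3' : HypA3 (cutoffWeight Ω (jOmega (Pf q.1).β Ω)) (ψf q.1) (ρf q.1) ((Pf q.1).flow q.2.2) a hh κ Ω R M := hA3
  exact hA3'.norm_Kbar_le hχ hgb hh0 ha0.le hc.aStar_lt.le hratio hϑR hK₀' j

omit [∀ j, CompleteSpace (W j)] in
/-- At an admissible point, a point obeying the `j`-th bounds lies in `D_j`. [cite: BauerschmidtBrydgesSlade2015Flow, §3.2] -/
theorem mem_flowDomain_of_boundAt (hc : ConstHyp Ω c lam C a κ R M aStar b hh)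
    (hA : ∀ m, HypA1 (Pf m).β Ω B c ∧ HypA2 (Pf m) Ω lam c C) {q : Mext × (W 0 × ℝ)}
    (hq : Adm Pf ψf ρf Ω B c lam C a κ R M aStar b hh q) {j : ℕ} {xj : W j × V3}
    (hb : BoundAt ψf Pf Ω a aStar hh b q j xj) :
    xj ∈ flowDomain (chi (Pf q.1).β Ω) ((Pf q.1).flow q.2.2) a hh j := by
  have hgq : q.2.2 ≤ quadThreshold Ω B c C lam :=
    hq.2.1.trans ((min_le_left _ _).trans ((min_le_left _ _).trans (min_le_left _ _)))
  obtain ⟨h, -, -⟩ := cutoffQuadHyp_of_hypA hc.one_lt_Ω (hA q.1).1 (hA q.1).2 hq.1 hgq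
  have hh0 : 0 ≤ hh := le_trans zero_le_one ((one_le_hThreshold Ω c C lam M a aStar κ b).trans hc.hh_ge)
  obtain ⟨b1, b2, b3, b4⟩ := hb
  exact mem_flowDomain_of_bounds (h.weight_pos j).le (by rw [QuadFlowParams.flow_apply_zero]; exact (h.gbar_pos j).le)
    hh0 hc.b_lt.le (by linarith [hc.aStar_lt]) (norm_Kb_le ψf ρf hc hA hq j) b1 b2 b3 b4

omit [∀ j, CompleteSpace (W j)] in
/-- `x̄_j = (K̄_j, V̄_j)` obeys the bounds trivially. [cite: BauerschmidtBrydgesSlade2015Flow, §3.2] -/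
theorem boundAt_base (hc : ConstHyp Ω c lam C a κ R M aStar b hh)
    (hA : ∀ m, HypA1 (Pf m).β Ω B c ∧ HypA2 (Pf m) Ω lam c C) {q : Mext × (W 0 × ℝ)}
    (hq : Adm Pf ψf ρf Ω B c lam C a κ R M aStar b hh q) (j : ℕ) :
    BoundAt ψf Pf Ω a aStar hh b q j (Kb ψf Pf q j, (Pf q.1).flow q.2.2 j) := by
  have hgq : q.2.2 ≤ quadThreshold Ω B c C lam :=
    hq.2.1.trans ((min_le_left _ _).trans ((min_le_left _ _).trans (min_le_left _ _)))
  obtain ⟨h, -, -⟩ := cutoffQuadHyp_of_hypA hc.one_lt_Ω (hA q.1).1 (hA q.1).2 hq.1 hgq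
  have hh0 : 0 ≤ hh := le_trans zero_le_one ((one_le_hThreshold Ω c C lam M a aStar κ b).trans hc.hh_ge)
  have hw := (h.weight_pos j).le
  have hg : 0 ≤ (Pf q.1).flow q.2.2 j 0 := by rw [QuadFlowParams.flow_apply_zero]; exact (h.gbar_pos j).le
  have hb := hc.b_pos.le; have haS : 0 ≤ a - aStar := by linarith [hc.aStar_lt]
  refine ⟨?_, ?_, ?_, ?_⟩ <;> simp only [sub_self, norm_zero, abs_zero]
  · have : chi (Pf q.1).β Ω j = cutoffWeight Ω (jOmega (Pf q.1).β Ω) j := rfl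
    rw [this]; positivity
  · positivity
  · have : chi (Pf q.1).β Ω j = cutoffWeight Ω (jOmega (Pf q.1).β Ω) j := rfl
    rw [this]; positivity
  · have : chi (Pf q.1).β Ω j = cutoffWeight Ω (jOmega (Pf q.1).β Ω) j := rfl
    rw [this]; positivity

/-- A uniform bound for the initial `𝒱`-component of the critical flow over admissible points (used for
compactness in `ℝ³`): `|g₀| ≤ 1`, `|z₀| ≤ Z + 𝗁`, `|μ₀| ≤ M_μ + 𝗁`.
[cite: BauerschmidtBrydgesSlade2015Flow, Corollary 1.8 (proof: "V₀(m',u₀') is uniformly bounded")] -/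
theorem norm_critFlow_zero_le (hc : ConstHyp Ω c lam C a κ R M aStar b hh)
    (hA : ∀ m, HypA1 (Pf m).β Ω B c ∧ HypA2 (Pf m) Ω lam c C) {q : Mext × (W 0 × ℝ)}
    (hq : Adm Pf ψf ρf Ω B c lam C a κ R M aStar b hh q) :
    ‖(critFlow ψf ρf hc hA q 0).2‖ ≤
      1 + (2 * C * ((1 + ⌊c⁻¹⌋₊) / c + ⌊c⁻¹⌋₊ + 2 * Ω / (Ω - 1)) + hh) +
        (4 * (C * (3 + 3 * (2 * C * ((1 + ⌊c⁻¹⌋₊) / c + ⌊c⁻¹⌋₊ + 2 * Ω / (Ω - 1))) +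
          (2 * C * ((1 + ⌊c⁻¹⌋₊) / c + ⌊c⁻¹⌋₊ + 2 * Ω / (Ω - 1))) ^ 2) / 2) / (lam - 1) + hh) := by
  obtain ⟨-, -, -, hg0, -, -, hbd, -⟩ := critFlow_spec ψf ρf hc hA hq
  have hgq : q.2.2 ≤ quadThreshold Ω B c C lam :=
    hq.2.1.trans ((min_le_left _ _).trans ((min_le_left _ _).trans (min_le_left _ _)))
  obtain ⟨h, -, -⟩ := cutoffQuadHyp_of_hypA hc.one_lt_Ω (hA q.1).1 (hA q.1).2 hq.1 hgq
  have hh0 : 0 ≤ hh := le_trans zero_le_one ((one_le_hThreshold Ω c C lam M a aStar κ b).trans hc.hh_ge)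
  obtain ⟨-, b2, b3, b4⟩ := hbd 0
  simp only [QuadFlowParams.flow_apply_zero, QuadFlowParams.flow_apply_one, QuadFlowParams.flow_apply_two,
    gbar_zero] at b2 b3 b4
  have hZ := h.abs_zbar_le' 0
  obtain ⟨hM0, hMu⟩ := h.abs_mubar_le_Mmu 0
  simp only [gbar_zero] at hZ hMu
  have hgL : q.2.2 * |Real.log q.2.2| ≤ 1 := by simpa using h.gbar_mul_abs_log_le_one 0
  have hχ1 : chi (Pf q.1).β Ω 0 ≤ 1 := h.weight_le_one 0
  have hχ0 : 0 ≤ chi (Pf q.1).β Ω 0 := (h.weight_pos 0).le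
  have hg1 : q.2.2 ≤ 1 := by linarith [h.gbar_le_half 0, gbar_zero (Pf q.1).β q.2.2]
  have hb1 := hc.b_lt.le; have hb0 := hc.b_pos.le
  have hZ0 := h.Z_nonneg
  have hlog : 0 ≤ |Real.log q.2.2| := abs_nonneg _
  -- the three coordinates
  have e0 : |(critFlow ψf ρf hc hA q 0).2 0| ≤ 1 := by rw [hg0, abs_of_pos hq.1]; exact hg1
  have hq2 : q.2.2 ^ 2 * |Real.log q.2.2| ≤ 1 := by
    calc q.2.2 ^ 2 * |Real.log q.2.2| = q.2.2 * (q.2.2 * |Real.log q.2.2|) := by ring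
      _ ≤ 1 * 1 := mul_le_mul hg1 hgL (by have := hq.1.le; positivity) zero_le_one
      _ = 1 := one_mul 1
  have e1 : |(critFlow ψf ρf hc hA q 0).2 1| ≤ 2 * C * ((1 + ⌊c⁻¹⌋₊) / c + ⌊c⁻¹⌋₊ + 2 * Ω / (Ω - 1)) + hh := by
    have t : |(critFlow ψf ρf hc hA q 0).2 1 - (Pf q.1).zbar q.2.2 0| ≤ hh := by
      calc _ ≤ b * hh * chi (Pf q.1).β Ω 0 * q.2.2 ^ 2 * |Real.log q.2.2| := b3
        _ = (b * chi (Pf q.1).β Ω 0) * (q.2.2 ^ 2 * |Real.log q.2.2|) * hh := by ring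
        _ ≤ (1 * 1) * 1 * hh := by gcongr
        _ = hh := by ring
    have hz : |(Pf q.1).zbar q.2.2 0| ≤ 2 * C * ((1 + ⌊c⁻¹⌋₊) / c + ⌊c⁻¹⌋₊ + 2 * Ω / (Ω - 1)) :=
      hZ.trans (mul_le_of_le_one_right hZ0 hg1)
    calc |(critFlow ψf ρf hc hA q 0).2 1|
        = |(Pf q.1).zbar q.2.2 0 + ((critFlow ψf ρf hc hA q 0).2 1 - (Pf q.1).zbar q.2.2 0)| := by rw [add_sub_cancel]
      _ ≤ |(Pf q.1).zbar q.2.2 0| + |(critFlow ψf ρf hc hA q 0).2 1 - (Pf q.1).zbar q.2.2 0| := abs_add_le _ _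
      _ ≤ _ := add_le_add hz t
  have e2 : |(critFlow ψf ρf hc hA q 0).2 2| ≤
      4 * (C * (3 + 3 * (2 * C * ((1 + ⌊c⁻¹⌋₊) / c + ⌊c⁻¹⌋₊ + 2 * Ω / (Ω - 1))) +
        (2 * C * ((1 + ⌊c⁻¹⌋₊) / c + ⌊c⁻¹⌋₊ + 2 * Ω / (Ω - 1))) ^ 2) / 2) / (lam - 1) + hh := by
    have t : |(critFlow ψf ρf hc hA q 0).2 2 - (Pf q.1).mubar q.2.2 0| ≤ hh := by
      calc _ ≤ b * hh * chi (Pf q.1).β Ω 0 * q.2.2 ^ 2 * |Real.log q.2.2| := b4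
        _ = (b * chi (Pf q.1).β Ω 0) * (q.2.2 ^ 2 * |Real.log q.2.2|) * hh := by ring
        _ ≤ (1 * 1) * 1 * hh := by gcongr
        _ = hh := by ring
    have hm := hMu.trans (mul_le_of_le_one_right hM0 hg1)
    calc |(critFlow ψf ρf hc hA q 0).2 2|
        = |(Pf q.1).mubar q.2.2 0 + ((critFlow ψf ρf hc hA q 0).2 2 - (Pf q.1).mubar q.2.2 0)| := by rw [add_sub_cancel]
      _ ≤ |(Pf q.1).mubar q.2.2 0| + |(critFlow ψf ρf hc hA q 0).2 2 - (Pf q.1).mubar q.2.2 0| := abs_add_le _ _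
      _ ≤ _ := add_le_add hm t
  have hpos1 : 0 ≤ 2 * C * ((1 + ⌊c⁻¹⌋₊) / c + ⌊c⁻¹⌋₊ + 2 * Ω / (Ω - 1)) + hh := by linarith
  have hpos2 : 0 ≤ 4 * (C * (3 + 3 * (2 * C * ((1 + ⌊c⁻¹⌋₊) / c + ⌊c⁻¹⌋₊ + 2 * Ω / (Ω - 1))) +
      (2 * C * ((1 + ⌊c⁻¹⌋₊) / c + ⌊c⁻¹⌋₊ + 2 * Ω / (Ω - 1))) ^ 2) / 2) / (lam - 1) + hh := by linarith
  refine norm_V3_le (by linarith) ?_ ?_ ?_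
  · linarith
  · linarith
  · linarith

end Corollary18b


/-! ### [BBS-rg-flow, Corollary 1.8]: passing to the limit, the orbit argument, and the conclusion -/

section Corollary18c

variable {Mext : Type*} [TopologicalSpace Mext]
variable {W : ℕ → Type*} [∀ j, NormedAddCommGroup (W j)] [∀ j, NormedSpace ℝ (W j)] [∀ j, CompleteSpace (W j)]
variable {Pf : Mext → QuadFlowParams} (ψf : ∀ m : Mext, ∀ j, W j × V3 → W (j + 1)) (ρf : ∀ m : Mext, ∀ j, W j × V3 → V3)
  {Ω B c lam C a κ R M aStar b hh : ℝ}

/-- The uniform bound `R_V = 1 + (Z + 𝗁) + (M_μ + 𝗁)` for `‖V₀‖` over admissible points. [cite: BauerschmidtBrydgesSlade2015Flow, Corollary 1.8 (proof)] -/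
def V0Bound (Ω c C lam hh : ℝ) : ℝ :=
  1 + (2 * C * ((1 + ⌊c⁻¹⌋₊) / c + ⌊c⁻¹⌋₊ + 2 * Ω / (Ω - 1)) + hh) +
    (4 * (C * (3 + 3 * (2 * C * ((1 + ⌊c⁻¹⌋₊) / c + ⌊c⁻¹⌋₊ + 2 * Ω / (Ω - 1))) +
      (2 * C * ((1 + ⌊c⁻¹⌋₊) / c + ⌊c⁻¹⌋₊ + 2 * Ω / (Ω - 1))) ^ 2) / 2) / (lam - 1) + hh)

omit [TopologicalSpace Mext] in
/-- `‖V₀(q)‖ ≤ R_V` at admissible `q`. [cite: BauerschmidtBrydgesSlade2015Flow, Corollary 1.8 (proof)] -/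
theorem norm_critFlow_zero_le' (hc : ConstHyp Ω c lam C a κ R M aStar b hh)
    (hA : ∀ m, HypA1 (Pf m).β Ω B c ∧ HypA2 (Pf m) Ω lam c C) {q : Mext × (W 0 × ℝ)}
    (hq : Adm Pf ψf ρf Ω B c lam C a κ R M aStar b hh q) :
    ‖(critFlow ψf ρf hc hA q 0).2‖ ≤ V0Bound Ω c C lam hh :=
  norm_critFlow_zero_le ψf ρf hc hA hq

omit [∀ j, CompleteSpace (W j)] in
/-- Along a filter of admissible points converging to an admissible `q₀`, `V̄_j(q) → V̄_j(q₀)`.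
[cite: BauerschmidtBrydgesSlade2015Flow, Proposition 1.2 (continuity) as used in Corollary 1.8] -/
theorem tendsto_flow_of_le_nhds (hc : ConstHyp Ω c lam C a κ R M aStar b hh)
    (hA : ∀ m, HypA1 (Pf m).β Ω B c ∧ HypA2 (Pf m) Ω lam c C) (hP : CoeffContinuous Pf)
    {q₀ : Mext × (W 0 × ℝ)} (hq₀ : Adm Pf ψf ρf Ω B c lam C a κ R M aStar b hh q₀) {F : Filter (Mext × (W 0 × ℝ))}
    (hF : F ≤ 𝓝 q₀) (hadm : ∀ᶠ q in F, Adm Pf ψf ρf Ω B c lam C a κ R M aStar b hh q) (j : ℕ) :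
    Tendsto (fun q => (Pf q.1).flow q.2.2 j) F (𝓝 ((Pf q₀.1).flow q₀.2.2 j)) := by
  have hgt : gThreshold Ω B c C lam M a aStar κ R b hh ≤ quadThreshold Ω B c C lam :=
    (min_le_left _ _).trans ((min_le_left _ _).trans (min_le_left _ _))
  have hmem : (q₀.1, q₀.2.2) ∈ admSet Mext (quadThreshold Ω B c C lam) := ⟨hq₀.1, hq₀.2.1.trans hgt⟩
  have hcont := (continuousOn_flow_param (Mext := Mext) hc.one_lt_Ω hA hP j) (q₀.1, q₀.2.2) hmem
  have h2 : Tendsto (fun q : Mext × (W 0 × ℝ) => (q.1, q.2.2)) F (𝓝[admSet Mext (quadThreshold Ω B c C lam)] (q₀.1, q₀.2.2)) := by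
    refine tendsto_nhdsWithin_iff.2 ⟨?_, hadm.mono fun q hq => ⟨hq.1, hq.2.1.trans hgt⟩⟩
    exact ((continuous_fst.prodMk (continuous_snd.comp continuous_snd)).tendsto q₀).mono_left hF
  exact hcont.tendsto.comp h2

omit [∀ j, CompleteSpace (W j)] in
/-- **Passing to the limit in the bounds (1.11)–(1.14)** along a filter of admissible points ("we can now take
the limit of (1.11′)–(1.14′)"), using `χ_j(m') → χ_j(m)` and the continuity of `V̄_j`.
[cite: BauerschmidtBrydgesSlade2015Flow, Corollary 1.8 (proof)] -/
theorem boundAt_of_tendsto (hc : ConstHyp Ω c lam C a κ R M aStar b hh)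
    (hA : ∀ m, HypA1 (Pf m).β Ω B c ∧ HypA2 (Pf m) Ω lam c C) (hP : CoeffContinuous Pf)
    {q₀ : Mext × (W 0 × ℝ)} (hq₀ : Adm Pf ψf ρf Ω B c lam C a κ R M aStar b hh q₀) {j : ℕ}
    (hχ : ContinuousAt (fun m => chi (Pf m).β Ω j) q₀.1) {F : Filter (Mext × (W 0 × ℝ))} [F.NeBot]
    (hF : F ≤ 𝓝 q₀) (hadm : ∀ᶠ q in F, Adm Pf ψf ρf Ω B c lam C a κ R M aStar b hh q)
    {y : Mext × (W 0 × ℝ) → W j × V3} {ys : W j × V3} (hy : Tendsto y F (𝓝 ys))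
    (hK : Tendsto (fun q => Kb ψf Pf q j) F (𝓝 (Kb ψf Pf q₀ j)))
    (hb : ∀ᶠ q in F, BoundAt ψf Pf Ω a aStar hh b q j (y q)) :
    BoundAt ψf Pf Ω a aStar hh b q₀ j ys := by
  have hV := tendsto_flow_of_le_nhds ψf ρf hc hA hP hq₀ hF hadm j
  have hVi : ∀ i : Fin 3, Tendsto (fun q => (Pf q.1).flow q.2.2 j i) F (𝓝 ((Pf q₀.1).flow q₀.2.2 j i)) := fun i =>
    ((continuous_apply i).tendsto _).comp hV
  have hV0 := hVi 0
  have hgt : gThreshold Ω B c C lam M a aStar κ R b hh ≤ quadThreshold Ω B c C lam :=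
    (min_le_left _ _).trans ((min_le_left _ _).trans (min_le_left _ _))
  obtain ⟨h0, -, -⟩ := cutoffQuadHyp_of_hypA hc.one_lt_Ω (hA q₀.1).1 (hA q₀.1).2 hq₀.1 (hq₀.2.1.trans hgt)
  have hgpos : (Pf q₀.1).flow q₀.2.2 j 0 ≠ 0 := by rw [QuadFlowParams.flow_apply_zero]; exact (h0.gbar_pos j).ne'
  have hlog : Tendsto (fun q => |Real.log ((Pf q.1).flow q.2.2 j 0)|) F (𝓝 |Real.log ((Pf q₀.1).flow q₀.2.2 j 0)|) :=
    ((Real.continuousAt_log hgpos).tendsto.comp hV0).abs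
  have hχ' : Tendsto (fun q => chi (Pf q.1).β Ω j) F (𝓝 (chi (Pf q₀.1).β Ω j)) :=
    hχ.tendsto.comp ((continuous_fst.tendsto q₀).mono_left hF)
  have hy1 : Tendsto (fun q => (y q).1) F (𝓝 ys.1) := (continuous_fst.tendsto ys).comp hy
  have hy2 : ∀ i : Fin 3, Tendsto (fun q => (y q).2 i) F (𝓝 (ys.2 i)) := fun i =>
    ((continuous_apply i).tendsto _).comp ((continuous_snd.tendsto ys).comp hy)
  refine ⟨?_, ?_, ?_, ?_⟩
  · exact le_of_tendsto_of_tendsto (hy1.sub hK).norm ((tendsto_const_nhds.mul hχ').mul (hV0.pow 3))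
      (hb.mono fun q h => h.1)
  · exact le_of_tendsto_of_tendsto ((hy2 0).sub hV0).abs ((tendsto_const_nhds.mul (hV0.pow 2)).mul hlog)
      (hb.mono fun q h => h.2.1)
  · exact le_of_tendsto_of_tendsto ((hy2 1).sub (hVi 1)).abs (((tendsto_const_nhds.mul hχ').mul (hV0.pow 2)).mul hlog)
      (hb.mono fun q h => h.2.2.1)
  · exact le_of_tendsto_of_tendsto ((hy2 2).sub (hVi 2)).abs (((tendsto_const_nhds.mul hχ').mul (hV0.pow 2)).mul hlog)
      (hb.mono fun q h => h.2.2.2)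

/-- **The orbit argument of Corollary 1.8**: along any non-trivial filter of admissible points converging to
`q₀` along which `V₀` converges to some `V₀^*`, the whole critical flow converges to the critical flow at
`q₀` (the `Φ(m)`-orbit `x^*` of `(K₀, V₀^*)` is a flow with the boundary conditions and the bounds, hence
equals `x(m, u₀)` by uniqueness). [cite: BauerschmidtBrydgesSlade2015Flow, Corollary 1.8 (proof)] -/
theorem critFlow_tendsto_of_tendsto_zero (hc : ConstHyp Ω c lam C a κ R M aStar b hh)
    (hA : ∀ m, HypA1 (Pf m).β Ω B c ∧ HypA2 (Pf m) Ω lam c C) (hP : CoeffContinuous Pf)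
    (hψ : ∀ (j : ℕ) (m : Mext) (g : ℝ) (x : W j × V3), x ∈ flowDomain (chi (Pf m).β Ω) ((Pf m).flow g) a hh j →
      ContinuousAt (fun p : Mext × (W j × V3) => ψf p.1 j p.2) (m, x))
    (hρ : ∀ (j : ℕ) (m : Mext) (g : ℝ) (x : W j × V3), x ∈ flowDomain (chi (Pf m).β Ω) ((Pf m).flow g) a hh j →
      ContinuousAt (fun p : Mext × (W j × V3) => ρf p.1 j p.2) (m, x))
    {q₀ : Mext × (W 0 × ℝ)} (hq₀ : Adm Pf ψf ρf Ω B c lam C a κ R M aStar b hh q₀)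
    (hχ : ∀ j, ContinuousAt (fun m => chi (Pf m).β Ω j) q₀.1)
    {F : Filter (Mext × (W 0 × ℝ))} [F.NeBot] (hF : F ≤ 𝓝[{q | Adm Pf ψf ρf Ω B c lam C a κ R M aStar b hh q}] q₀)
    {Vs : V3} (hV : Tendsto (fun q => (critFlow ψf ρf hc hA q 0).2) F (𝓝 Vs)) (j : ℕ) :
    Tendsto (fun q => critFlow ψf ρf hc hA q j) F (𝓝 (critFlow ψf ρf hc hA q₀ j)) := by
  have hadm : ∀ᶠ q in F, Adm Pf ψf ρf Ω B c lam C a κ R M aStar b hh q := hF self_mem_nhdsWithin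
  have hF' : F ≤ 𝓝 q₀ := hF.trans nhdsWithin_le_nhds
  have hq1 : Tendsto (fun q : Mext × (W 0 × ℝ) => q.1) F (𝓝 q₀.1) := (continuous_fst.tendsto q₀).mono_left hF'
  have hK0 : Tendsto (fun q : Mext × (W 0 × ℝ) => q.2.1) F (𝓝 q₀.2.1) :=
    ((continuous_fst.comp continuous_snd).tendsto q₀).mono_left hF'
  have hg : Tendsto (fun q : Mext × (W 0 × ℝ) => q.2.2) F (𝓝 q₀.2.2) :=
    ((continuous_snd.comp continuous_snd).tendsto q₀).mono_left hF'
  -- `V₀^*` has `g`-coordinate `g₀`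
  have hVs0 : Vs 0 = q₀.2.2 := by
    have t1 : Tendsto (fun q => (critFlow ψf ρf hc hA q 0).2 0) F (𝓝 (Vs 0)) := ((continuous_apply 0).tendsto _).comp hV
    have t2 : Tendsto (fun q => (critFlow ψf ρf hc hA q 0).2 0) F (𝓝 q₀.2.2) :=
      hg.congr' (hadm.mono fun q hq => ((critFlow_spec ψf ρf hc hA hq).2.2.2.1).symm)
    exact tendsto_nhds_unique t1 t2
  -- the orbit `x^*` of `(K₀, V₀^*)` under `Φ(m)`
  let xs : ∀ j, W j × V3 := fun j => @Nat.rec (fun j => W j × V3) (q₀.2.1, Vs)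
    (fun j xj => (ψf q₀.1 j xj, (Pf q₀.1).map j xj.2 + ρf q₀.1 j xj)) j
  have xs0 : xs 0 = (q₀.2.1, Vs) := rfl
  have xsS : ∀ j, xs (j + 1) = (ψf q₀.1 j (xs j), (Pf q₀.1).map j (xs j).2 + ρf q₀.1 j (xs j)) := fun j => rfl
  -- the induction: `K̄_j(q) → K̄_j(q₀)`, `x_j(q) → x^*_j`, and `x^*_j` obeys the `j`-th bounds at `q₀`
  have ind : ∀ j, Tendsto (fun q => Kb ψf Pf q j) F (𝓝 (Kb ψf Pf q₀ j)) ∧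
      Tendsto (fun q => critFlow ψf ρf hc hA q j) F (𝓝 (xs j)) ∧ BoundAt ψf Pf Ω a aStar hh b q₀ j (xs j) := by
    intro j
    induction j with
    | zero =>
      have hK : Tendsto (fun q => Kb ψf Pf q 0) F (𝓝 (Kb ψf Pf q₀ 0)) := hK0
      have hc0 : Tendsto (fun q => critFlow ψf ρf hc hA q 0) F (𝓝 (xs 0)) := by
        have t1 : Tendsto (fun q => (critFlow ψf ρf hc hA q 0).1) F (𝓝 q₀.2.1) :=
          hK0.congr' (hadm.mono fun q hq => ((critFlow_spec ψf ρf hc hA hq).2.2.1).symm)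
        simpa only [xs0, Prod.mk.eta] using t1.prodMk_nhds hV
      refine ⟨hK, hc0, ?_⟩
      exact boundAt_of_tendsto ψf ρf hc hA hP hq₀ (hχ 0) hF' hadm hc0 hK
        (hadm.mono fun q hq => ((flowBounds_iff_boundAt ψf q _).1 (critFlow_spec ψf ρf hc hA hq).2.2.2.2.2.2.1) 0)
    | succ j ih =>
      obtain ⟨hKj, hcj, hbj⟩ := ih
      have hVj := tendsto_flow_of_le_nhds ψf ρf hc hA hP hq₀ hF' hadm j
      have hdom : xs j ∈ flowDomain (chi (Pf q₀.1).β Ω) ((Pf q₀.1).flow q₀.2.2) a hh j :=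
        mem_flowDomain_of_boundAt ψf ρf hc hA hq₀ hbj
      have hdom0 : (Kb ψf Pf q₀ j, (Pf q₀.1).flow q₀.2.2 j) ∈ flowDomain (chi (Pf q₀.1).β Ω) ((Pf q₀.1).flow q₀.2.2) a hh j :=
        mem_flowDomain_of_boundAt ψf ρf hc hA hq₀ (boundAt_base ψf ρf hc hA hq₀ j)
      -- `K̄_{j+1}(q) = ψ_j(m')(K̄_j(q), V̄_j(q)) → ψ_j(m)(K̄_j(q₀), V̄_j(q₀))`
      have hK : Tendsto (fun q => Kb ψf Pf q (j + 1)) F (𝓝 (Kb ψf Pf q₀ (j + 1))) := by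
        have := (hψ j q₀.1 q₀.2.2 _ hdom0).tendsto.comp (hq1.prodMk_nhds (hKj.prodMk_nhds hVj))
        exact this
      -- `x_{j+1}(q) = Φ_j(m')(x_j(q)) → Φ_j(m)(x^*_j) = x^*_{j+1}`
      have hcS : Tendsto (fun q => critFlow ψf ρf hc hA q (j + 1)) F (𝓝 (xs (j + 1))) := by
        have tψ : Tendsto (fun q => ψf q.1 j (critFlow ψf ρf hc hA q j)) F (𝓝 (ψf q₀.1 j (xs j))) :=
          (hψ j q₀.1 q₀.2.2 _ hdom).tendsto.comp (hq1.prodMk_nhds hcj)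
        have tρ : Tendsto (fun q => ρf q.1 j (critFlow ψf ρf hc hA q j)) F (𝓝 (ρf q₀.1 j (xs j))) :=
          (hρ j q₀.1 q₀.2.2 _ hdom).tendsto.comp (hq1.prodMk_nhds hcj)
        have tm : Tendsto (fun q => (Pf q.1).map j (critFlow ψf ρf hc hA q j).2) F (𝓝 ((Pf q₀.1).map j (xs j).2)) :=
          ((continuous_map_param hP j).tendsto _).comp (hq1.prodMk_nhds ((continuous_snd.tendsto _).comp hcj))
        have tall := tψ.prodMk_nhds (tm.add tρ)
        rw [xsS]
        refine tall.congr' (hadm.mono fun q hq => ?_)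
        exact ((critFlow_spec ψf ρf hc hA hq).2.1 j).symm
      refine ⟨hK, hcS, ?_⟩
      exact boundAt_of_tendsto ψf ρf hc hA hP hq₀ (hχ (j + 1)) hF' hadm hcS hK
        (hadm.mono fun q hq => ((flowBounds_iff_boundAt ψf q _).1 (critFlow_spec ψf ρf hc hA hq).2.2.2.2.2.2.1) (j + 1))
  -- `x^*` is a flow at `q₀` with the boundary conditions and the bounds
  have hflow : IsPerturbedFlow (Pf q₀.1) (ψf q₀.1) (ρf q₀.1) xs := fun j => rfl
  have hx0 : (xs 0).1 = q₀.2.1 := rfl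
  have hxg : (xs 0).2 0 = q₀.2.2 := hVs0
  have hbds : FlowBounds (chi (Pf q₀.1).β Ω) (ψf q₀.1) ((Pf q₀.1).flow q₀.2.2) q₀.2.1 a aStar hh b xs :=
    (flowBounds_iff_boundAt ψf q₀ xs).2 fun j => (ind j).2.2
  have hgt : gThreshold Ω B c C lam M a aStar κ R b hh ≤ quadThreshold Ω B c C lam :=
    (min_le_left _ _).trans ((min_le_left _ _).trans (min_le_left _ _))
  obtain ⟨h0, -, -⟩ := cutoffQuadHyp_of_hypA hc.one_lt_Ω (hA q₀.1).1 (hA q₀.1).2 hq₀.1 (hq₀.2.1.trans hgt)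
  have hh0 : 0 ≤ hh := le_trans zero_le_one ((one_le_hThreshold Ω c C lam M a aStar κ b).trans hc.hh_ge)
  have hsmallseq : Tendsto (fun j => b * hh * (chi (Pf q₀.1).β Ω j * gbar (Pf q₀.1).β q₀.2.2 j)) atTop (𝓝 0) := by
    have := h0.tendsto_weight_mul_gbar_zero.const_mul (b * hh)
    rw [mul_zero] at this
    exact this
  have hdev : ∀ j (i : Fin 3), i ≠ 0 →
      |(xs j).2 i - (Pf q₀.1).flow q₀.2.2 j i| ≤ b * hh * (chi (Pf q₀.1).β Ω j * gbar (Pf q₀.1).β q₀.2.2 j) := by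
    intro j i hi
    obtain ⟨-, -, b3, b4⟩ := (ind j).2.2
    have hgL := h0.gbar_mul_abs_log_le_one j
    have hw := (h0.weight_pos j).le; have hgp := (h0.gbar_pos j).le; have hb := hc.b_pos.le
    have key : b * hh * chi (Pf q₀.1).β Ω j * (Pf q₀.1).flow q₀.2.2 j 0 ^ 2 * |Real.log ((Pf q₀.1).flow q₀.2.2 j 0)| ≤
        b * hh * (chi (Pf q₀.1).β Ω j * gbar (Pf q₀.1).β q₀.2.2 j) := by
      rw [QuadFlowParams.flow_apply_zero]
      have : chi (Pf q₀.1).β Ω j = cutoffWeight Ω (jOmega (Pf q₀.1).β Ω) j := rfl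
      rw [this]
      calc b * hh * cutoffWeight Ω (jOmega (Pf q₀.1).β Ω) j * gbar (Pf q₀.1).β q₀.2.2 j ^ 2 *
            |Real.log (gbar (Pf q₀.1).β q₀.2.2 j)|
          = b * hh * (cutoffWeight Ω (jOmega (Pf q₀.1).β Ω) j * gbar (Pf q₀.1).β q₀.2.2 j) *
              (gbar (Pf q₀.1).β q₀.2.2 j * |Real.log (gbar (Pf q₀.1).β q₀.2.2 j)|) := by ring
        _ ≤ b * hh * (cutoffWeight Ω (jOmega (Pf q₀.1).β Ω) j * gbar (Pf q₀.1).β q₀.2.2 j) * 1 := by gcongr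
        _ = _ := mul_one _
    fin_cases i
    · exact absurd rfl hi
    · exact b3.trans key
    · exact b4.trans key
  have tz : Tendsto (fun j => (xs j).2 1) atTop (𝓝 0) := by
    have t1 : Tendsto (fun j => (Pf q₀.1).flow q₀.2.2 j 1) atTop (𝓝 0) := by
      simpa [QuadFlowParams.flow_apply_one] using h0.tendsto_zbar_zero
    have t2 : Tendsto (fun j => (xs j).2 1 - (Pf q₀.1).flow q₀.2.2 j 1) atTop (𝓝 0) :=
      squeeze_zero_norm (fun j => (Real.norm_eq_abs _).trans_le (hdev j 1 (by decide))) hsmallseq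
    simpa using t2.add t1
  have tμ : Tendsto (fun j => (xs j).2 2) atTop (𝓝 0) := by
    have t1 : Tendsto (fun j => (Pf q₀.1).flow q₀.2.2 j 2) atTop (𝓝 0) := by
      simpa [QuadFlowParams.flow_apply_two] using h0.tendsto_mubar_zero
    have t2 : Tendsto (fun j => (xs j).2 2 - (Pf q₀.1).flow q₀.2.2 j 2) atTop (𝓝 0) :=
      squeeze_zero_norm (fun j => (Real.norm_eq_abs _).trans_le (hdev j 2 (by decide))) hsmallseq
    simpa using t2.add t1
  -- uniqueness at `q₀`
  have huniq : xs = critFlow ψf ρf hc hA q₀ :=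
    (critFlow_spec ψf ρf hc hA hq₀).2.2.2.2.2.2.2 xs hflow hx0 hxg tz tμ hbds
  rw [← huniq]
  exact (ind j).2.1

/-- **[BBS-rg-flow, Corollary 1.8]**: assume `Φ_j(·, m) = (ψ(m), φ̄(m) + ρ(m))` are continuous in `(m, x)` at
the points of the domains, the coefficients of `φ̄(m)` are continuous in `m`, (A1)–(A3) hold for every `m`
with `m`-independent parameters, and `χ_j(m') → χ_j(m)` (the paper's implicit assumption, made explicit).
Let `x(m, u₀)`, `u₀ = (K₀, g₀)`, be the global flow of Theorem 1.4 (`critFlow`). Then for each `j`,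
`x_j` is continuous in `(m, u₀)` at every admissible point, within the admissible set.
[cite: BauerschmidtBrydgesSlade2015Flow, Corollary 1.8] -/
theorem critFlow_continuousWithinAt (hc : ConstHyp Ω c lam C a κ R M aStar b hh)
    (hA : ∀ m, HypA1 (Pf m).β Ω B c ∧ HypA2 (Pf m) Ω lam c C) (hP : CoeffContinuous Pf)
    (hψ : ∀ (j : ℕ) (m : Mext) (g : ℝ) (x : W j × V3), x ∈ flowDomain (chi (Pf m).β Ω) ((Pf m).flow g) a hh j →
      ContinuousAt (fun p : Mext × (W j × V3) => ψf p.1 j p.2) (m, x))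
    (hρ : ∀ (j : ℕ) (m : Mext) (g : ℝ) (x : W j × V3), x ∈ flowDomain (chi (Pf m).β Ω) ((Pf m).flow g) a hh j →
      ContinuousAt (fun p : Mext × (W j × V3) => ρf p.1 j p.2) (m, x))
    {q₀ : Mext × (W 0 × ℝ)} (hq₀ : Adm Pf ψf ρf Ω B c lam C a κ R M aStar b hh q₀)
    (hχ : ∀ j, ContinuousAt (fun m => chi (Pf m).β Ω j) q₀.1) (j : ℕ) :
    ContinuousWithinAt (fun q => critFlow ψf ρf hc hA q j) {q | Adm Pf ψf ρf Ω B c lam C a κ R M aStar b hh q} q₀ := by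
  set A := {q : Mext × (W 0 × ℝ) | Adm Pf ψf ρf Ω B c lam C a κ R M aStar b hh q} with hAset
  haveI : (𝓝[A] q₀).NeBot := mem_closure_iff_nhdsWithin_neBot.1 (subset_closure hq₀)
  -- continuity of `V₀` by compactness and uniqueness of the cluster point
  have T0 : Tendsto (fun q => (critFlow ψf ρf hc hA q 0).2) (𝓝[A] q₀) (𝓝 (critFlow ψf ρf hc hA q₀ 0).2) := by
    refine (isCompact_closedBall (0 : V3) (V0Bound Ω c C lam hh)).tendsto_nhds_of_unique_mapClusterPt ?_ ?_
    · exact (eventually_mem_nhdsWithin).mono fun q hq => mem_closedBall_zero_iff.2 (norm_critFlow_zero_le' ψf ρf hc hA hq)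
    · intro V _ hcl
      obtain ⟨F, hne, hle, hT⟩ := exists_le_tendsto_of_mapClusterPt hcl
      haveI := hne
      have h1 := critFlow_tendsto_of_tendsto_zero ψf ρf hc hA hP hψ hρ hq₀ hχ hle hT 0
      have h2 : Tendsto (fun q => (critFlow ψf ρf hc hA q 0).2) F (𝓝 (critFlow ψf ρf hc hA q₀ 0).2) :=
        (continuous_snd.tendsto _).comp h1
      exact tendsto_nhds_unique hT h2
  exact critFlow_tendsto_of_tendsto_zero ψf ρf hc hA hP hψ hρ hq₀ hχ le_rfl T0 j

end Corollary18c


end CTWSAW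

end Literature.Barriers.CriticalPhenomena
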